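import Mathlib
import Summits.KontsevichZagierPeriods.Zeta5Search.GHatMomentsProof
import Summits.KontsevichZagierPeriods.Zeta5Search.GHatShiftMomentsProof
import Summits.KontsevichZagierPeriods.Zeta5Search.DoubleDropBonusProof
import Summits.KontsevichZagierPeriods.Zeta5Search.LevelClassDigits
import HarnessLib

/-!
# ζ(5) search — `p`-integral rationals versus `ZMod p` (norm form), and class data under the shift `b ↦ b + e_j`
# (tools for gen-2 g9's `CollinearityCriterion`, part 1 of 4)

Cell `pub-zeta5` (HONEST FRAMING: systematic search; no irrationality claim unless certified), typer seat generation 10.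

* §1 norm ↔ `ZMod p` bridge for `p`-integral rationals (`PInt.of_padicNorm_le_one`, `PInt.padicNorm_le_one`,
  `PInt.cast_eq_zero_iff_norm`, `PInt.cast_eq_of_norm_sub_le`, `PInt.cast_eq_zero_of_pCong`, `PInt.norm_le_one_of_near`),
  complementing `GHatMomentsResidue` §B;
* §2 class data are SHIFT-INVARIANT on classes not hit by `b ↦ b + e_j` (`classPoles`, `classCofactor`, `classRho`, `cHat`, `vHat`,
  `classPoleCount`, `sigmaK`: all functions of the net exponents on the class, which are unchanged by
  `netExp_shift_eq_of_classExp_eq`), and the deep classes of `b + e_j` are exactly the unhit deep classes of `b` (`deepClasses_shift`,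
  from P1 g5's exact `CellA.netExp_shift_eq`).

Bookkeeping on rational numbers and finite sets; nothing here bears on irrationality.
-/

noncomputable section

open Finset

namespace Summit.KontsevichZagierPeriods.Zeta5Search.ClusterValuation

open Summit.KontsevichZagierPeriods.Zeta5Search.DualSeries (InBox)
open Summit.KontsevichZagierPeriods.Zeta5Search.WedgeDictionary (coeffV dOf)
open Summit.KontsevichZagierPeriods.Zeta5Search.CasoratianValuation (InPolytope shift)
open Summit.KontsevichZagierPeriods.Zeta5Search.BigPrime (shift_zero)
open Summit.KontsevichZagierPeriods.Zeta5Search.PadicSeries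
open Summit.KontsevichZagierPeriods.Zeta5Search.LevelClass (padicNorm_vHat_le_one padicNorm_gHat_sub_le digit_swap
  padicNorm_normalise)
open Summit.KontsevichZagierPeriods.Zeta5Search.CellA (small_add small_mul padicNorm_classRho_le_one)
open Literature.NumberTheory.Transcendental.BallRivoal (harm)

variable {p : ℕ} [hp : Fact p.Prime]

/-! ## §1  Norms versus images in `ZMod p` -/

namespace PInt

/-- A rational of norm `≤ 1` is `p`-integral. -/
theorem of_padicNorm_le_one {r : ℚ} (h : padicNorm p r ≤ 1) : ¬ p ∣ r.den := by
  intro hd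
  by_cases hr : r = 0
  · subst hr
    exact hp.out.ne_one (Nat.dvd_one.1 (by simpa using hd))
  · have hnum : ¬ (p : ℤ) ∣ r.num := by
      intro hn
      have hcop : Nat.gcd r.num.natAbs r.den = 1 := r.reduced
      have : p ∣ Nat.gcd r.num.natAbs r.den := Nat.dvd_gcd (Int.natCast_dvd.1 hn) hd
      rw [hcop] at this
      exact hp.out.ne_one (Nat.dvd_one.1 this)
    have hv : padicValRat p r < 0 := by
      have h1 : 1 ≤ padicValNat p r.den := one_le_padicValNat_of_dvd r.den_nz hd
      rw [padicValRat, padicValInt.eq_zero_of_not_dvd hnum]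
      omega
    rw [padicNorm.eq_zpow_of_nonzero hr] at h
    have : (1 : ℚ) < (p : ℚ) ^ (-padicValRat p r) := one_lt_zpow₀ (by exact_mod_cast hp.out.one_lt) (by omega)
    linarith

/-- A `p`-integral rational has norm `≤ 1`. -/
theorem padicNorm_le_one {r : ℚ} (hr : ¬ p ∣ r.den) : padicNorm p r ≤ 1 := by
  by_cases h0 : r = 0
  · rw [h0, padicNorm.zero]; exact zero_le_one
  · have hv : 0 ≤ padicValRat p r := by
      rw [padicValRat, padicValNat.eq_zero_of_not_dvd hr]; omega
    rw [padicNorm.eq_zpow_of_nonzero h0]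
    exact zpow_le_one_of_nonpos₀ (by exact_mod_cast hp.out.one_lt.le) (by omega)

/-- For a `p`-integral rational: image `0` in `ZMod p` iff norm `≤ p⁻¹`. -/
theorem cast_eq_zero_iff_norm {r : ℚ} (hr : ¬ p ∣ r.den) :
    (r : ZMod p) = 0 ↔ padicNorm p r ≤ (p : ℚ) ^ (-(1 : ℤ)) := by
  rw [Rat.cast_def, div_eq_zero_iff, or_iff_left (den_ne_zero hr), ZMod.intCast_zmod_eq_zero_iff_dvd]
  constructor
  · intro h
    rcases (padicValInt_dvd_iff 1 r.num).1 (by rwa [pow_one]) with h0 | h1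
    · rw [Rat.num_eq_zero.1 h0, padicNorm.zero]; exact zpow_p_nonneg _
    · refine padicNorm_le_of_val fun _ => ?_
      rw [padicValRat, padicValNat.eq_zero_of_not_dvd hr]; omega
  · intro h
    by_cases h0 : r = 0
    · simp [h0]
    · have hv := val_ge_of_padicNorm_le h0 h
      rw [padicValRat, padicValNat.eq_zero_of_not_dvd hr] at hv
      have h1 : 1 ≤ padicValInt p r.num := by omega
      have := (padicValInt_dvd_iff 1 r.num).2 (Or.inr h1)
      rwa [pow_one] at this

/-- Congruent `p`-integral rationals have the same image in `ZMod p`. -/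
theorem cast_eq_of_norm_sub_le {r s : ℚ} (hr : ¬ p ∣ r.den) (hs : ¬ p ∣ s.den)
    (h : padicNorm p (r - s) ≤ (p : ℚ) ^ (-(1 : ℤ))) : (r : ZMod p) = s := by
  rw [← sub_eq_zero, ← cast_sub hr hs]
  exact (cast_eq_zero_iff_norm (sub hr hs)).2 h

/-- `pCong` (a `p`-integral rational `≡ 0 (mod p)`) gives image `0` in `ZMod p`. -/
theorem cast_eq_zero_of_pCong {r : ℚ} (hr : ¬ p ∣ r.den) (h : pCong p r = true) : (r : ZMod p) = 0 := by
  rw [pCong, decide_eq_true_iff] at h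
  rcases h with h | h
  · simp [h]
  · exact (cast_eq_zero_iff_norm hr).2 (padicNorm_le_of_val fun _ => h)

/-- A rational within `p⁻¹` of a rational of norm `≤ 1` has norm `≤ 1`. -/
theorem norm_le_one_of_near {r s : ℚ} (hs : padicNorm p s ≤ 1) (h : padicNorm p (r - s) ≤ (p : ℚ) ^ (-(1 : ℤ))) :
    padicNorm p r ≤ 1 := by
  have e : r = (r - s) + s := by ring
  rw [e]
  refine (padicNorm.nonarchimedean (p := p)).trans (max_le (h.trans ?_) hs)
  exact zpow_le_one_of_nonpos₀ (by exact_mod_cast hp.out.one_lt.le) (by norm_num)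

end PInt

/-! ## §2  Class data under the shift `b ↦ b + e_j` -/

section ShiftInvariance

variable (b : ℕ → ℤ) {j : ℕ} (hb : InBox b) (hj1 : 1 ≤ j)
include hb hj1

omit hp in
/-- On an unhit class the pole set is unchanged. -/
theorem classPoles_shift_of_classExp_eq {x : ℕ} (hE : classExp (shift b j) p x = classExp b p x) :
    classPoles (shift b j) p x = classPoles b p x := by
  have hnet := netExp_shift_eq_of_classExp_eq b hb hj1 hE
  unfold classPoles
  rw [classSet_shift b hj1]
  exact filter_congr fun s hs => by rw [hnet s hs]

omit hb hj1 hp in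
/-- `classPoleCount` is the cardinality of `classPoles` (definitional). -/
theorem classPoleCount_eq_card_classPoles (p x : ℕ) : classPoleCount b p x = (classPoles b p x).card := rfl

omit hp in
/-- On an unhit class the pole count is unchanged. -/
theorem classPoleCount_shift_of_classExp_eq {x : ℕ} (hE : classExp (shift b j) p x = classExp b p x) :
    classPoleCount (shift b j) p x = classPoleCount b p x := by
  rw [classPoleCount_eq_card_classPoles, classPoleCount_eq_card_classPoles, classPoles_shift_of_classExp_eq b hb hj1 hE]

omit hp in
/-- On an unhit class the class cofactors are unchanged. -/
theorem classCofactor_shift_of_classExp_eq {x : ℕ} (hE : classExp (shift b j) p x = classExp b p x)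
    {q : ℕ} (hq : q ∈ classSet b p x) : classCofactor (shift b j) p q = classCofactor b p q := by
  have hnet := netExp_shift_eq_of_classExp_eq b hb hj1 hE
  have hqx : q % p = x % p := (mem_filter.1 hq).2
  have hcl : classSet b p q = classSet b p x := by
    unfold classSet; rw [hqx]
  unfold classCofactor
  rw [classSet_shift b hj1]
  have hprod : (∏ s ∈ (classSet b p q).erase q, binomSeries (((q : ℚ) - s) / p) (netExp (shift b j) s)) =
      ∏ s ∈ (classSet b p q).erase q, binomSeries (((q : ℚ) - s) / p) (netExp b s) :=
    prod_congr rfl fun s hs => by rw [hnet s (hcl ▸ mem_of_mem_erase hs)]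
  rw [hprod]
  by_cases h : ¬ (2 : ℤ) ∣ b 0 ∧ CentreIn b p q
  · rw [if_pos h, if_pos (show ¬ (2 : ℤ) ∣ shift b j 0 ∧ CentreIn (shift b j) p q by
      rw [shift_zero b hj1, centreIn_shift b hj1]; exact h), shift_zero b hj1]
  · rw [if_neg h, if_neg (show ¬ (¬ (2 : ℤ) ∣ shift b j 0 ∧ CentreIn (shift b j) p q) by
      rw [shift_zero b hj1, centreIn_shift b hj1]; exact h)]

omit hp in
/-- On an unhit class the partial-fraction data `ρ_{q,σ}` are unchanged. -/
theorem classRho_shift_of_classExp_eq {x : ℕ} (hE : classExp (shift b j) p x = classExp b p x)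
    {q : ℕ} (hq : q ∈ classSet b p x) (σ : ℕ) : classRho (shift b j) p q σ = classRho b p q σ := by
  unfold classRho
  rw [netExp_shift_eq_of_classExp_eq b hb hj1 hE q hq, classCofactor_shift_of_classExp_eq b hb hj1 hE hq]

omit hp in
/-- On an unhit class `ĉ_x` is unchanged. -/
theorem cHat_shift_of_classExp_eq {x : ℕ} (hE : classExp (shift b j) p x = classExp b p x) :
    cHat (shift b j) p x = cHat b p x := by
  have hnet := netExp_shift_eq_of_classExp_eq b hb hj1 hE
  unfold cHat
  rw [classPoles_shift_of_classExp_eq b hb hj1 hE]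
  refine sum_congr rfl fun q hq => ?_
  have hqC : q ∈ classSet b p x := (mem_filter.1 hq).1
  rw [hnet q hqC, classRho_shift_of_classExp_eq b hb hj1 hE hqC, classRho_shift_of_classExp_eq b hb hj1 hE hqC]

omit hp in
/-- On an unhit class `v̂_x` is unchanged. -/
theorem vHat_shift_of_classExp_eq {x : ℕ} (hE : classExp (shift b j) p x = classExp b p x) :
    vHat (shift b j) p x = vHat b p x := by
  have hnet := netExp_shift_eq_of_classExp_eq b hb hj1 hE
  unfold vHat
  rw [classPoles_shift_of_classExp_eq b hb hj1 hE]
  refine sum_congr rfl fun q hq => ?_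
  have hqC : q ∈ classSet b p x := (mem_filter.1 hq).1
  rw [hnet q hqC]
  exact sum_congr rfl fun σ _ => by rw [classRho_shift_of_classExp_eq b hb hj1 hE hqC]

omit hp in
/-- On an unhit class `σ_K(x)` is unchanged. -/
theorem sigmaK_shift_of_classExp_eq {x : ℕ} (hE : classExp (shift b j) p x = classExp b p x) :
    sigmaK (shift b j) p x = sigmaK b p x := by
  unfold sigmaK
  rw [classPoleCount_shift_of_classExp_eq b hb hj1 hE, cHat_shift_of_classExp_eq b hb hj1 hE]

end ShiftInvariance

section DeepShift

variable (b : ℕ → ℤ) {j : ℕ} (hb : InBox b) (hj1 : 1 ≤ j) (hj7 : j ≤ 7) (h2 : 2 * b j ≤ b 0)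
include hb hj1 hj7 h2

omit hp in
/-- A class containing neither moved point keeps its class exponent. -/
theorem classExp_shift_of_unhit {x : ℕ} (h1 : (b j).toNat ∉ classSet b p x)
    (h2' : (b 0).toNat - (b j).toNat ∉ classSet b p x) : classExp (shift b j) p x = classExp b p x := by
  have hc : (if ¬ (2 : ℤ) ∣ shift b j 0 ∧ CentreIn (shift b j) p x then (1 : ℤ) else 0) =
      (if ¬ (2 : ℤ) ∣ b 0 ∧ CentreIn b p x then (1 : ℤ) else 0) := by
    by_cases h : ¬ (2 : ℤ) ∣ b 0 ∧ CentreIn b p x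
    · rw [if_pos h, if_pos (by rw [shift_zero b hj1, centreIn_shift b hj1]; exact h)]
    · rw [if_neg h, if_neg (by rw [shift_zero b hj1, centreIn_shift b hj1]; exact h)]
  unfold classExp
  rw [classSet_shift b hj1, hc]
  congr 1
  refine sum_congr rfl fun s hs => ?_
  rw [CellA.netExp_shift_eq b hb hj1 hj7 h2 s, if_neg (by rintro (rfl | rfl) <;> [exact h1 hs; exact h2' hs]), add_zero]

omit hp in
/-- A class containing a moved point rises by at least one. -/
theorem classExp_shift_of_hit {x : ℕ}
    (hhit : (b j).toNat ∈ classSet b p x ∨ (b 0).toNat - (b j).toNat ∈ classSet b p x) :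
    classExp b p x + 1 ≤ classExp (shift b j) p x := by
  have hc : (if ¬ (2 : ℤ) ∣ shift b j 0 ∧ CentreIn (shift b j) p x then (1 : ℤ) else 0) =
      (if ¬ (2 : ℤ) ∣ b 0 ∧ CentreIn b p x then (1 : ℤ) else 0) := by
    by_cases h : ¬ (2 : ℤ) ∣ b 0 ∧ CentreIn b p x
    · rw [if_pos h, if_pos (by rw [shift_zero b hj1, centreIn_shift b hj1]; exact h)]
    · rw [if_neg h, if_neg (by rw [shift_zero b hj1, centreIn_shift b hj1]; exact h)]
  unfold classExp
  rw [classSet_shift b hj1, hc]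
  have hsum : ∑ s ∈ classSet b p x, netExp (shift b j) s = ∑ s ∈ classSet b p x, netExp b s +
      ∑ s ∈ classSet b p x, (if s = (b j).toNat ∨ s = (b 0).toNat - (b j).toNat then (1 : ℤ) else 0) := by
    rw [← sum_add_distrib]
    exact sum_congr rfl fun s _ => CellA.netExp_shift_eq b hb hj1 hj7 h2 s
  have hone : (1 : ℤ) ≤
      ∑ s ∈ classSet b p x, (if s = (b j).toNat ∨ s = (b 0).toNat - (b j).toNat then (1 : ℤ) else 0) := by
    rcases hhit with h | h
    · exact le_trans (by rw [if_pos (Or.inl rfl)]) (single_le_sum (fun s _ => by positivity) h)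
    · exact le_trans (by rw [if_pos (Or.inr rfl)]) (single_le_sum (fun s _ => by positivity) h)
  rw [hsum]
  linarith

omit hp in
/-- **The deep classes of `b + e_j` are the unhit deep classes of `b`** (when `−N` bounds the class exponents of `b` from below). -/
theorem deepClasses_shift {N : ℕ} (hEN : ∀ x, x < p → -(N : ℤ) ≤ classExp b p x) :
    deepClasses (shift b j) p N = (deepClasses b p N).filter
      (fun x => (b j).toNat ∉ classSet b p x ∧ (b 0).toNat - (b j).toNat ∉ classSet b p x) := by
  ext x
  simp only [deepClasses, mem_filter, mem_range]
  constructor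
  · rintro ⟨hx, hE'⟩
    have hEx := hEN x hx
    by_cases hhit : (b j).toNat ∈ classSet b p x ∨ (b 0).toNat - (b j).toNat ∈ classSet b p x
    · have := classExp_shift_of_hit b hb hj1 hj7 h2 hhit; omega
    · push Not at hhit
      have := classExp_shift_of_unhit b hb hj1 hj7 h2 hhit.1 hhit.2
      exact ⟨⟨hx, by omega⟩, hhit.1, hhit.2⟩
  · rintro ⟨⟨hx, hE⟩, h1, h2'⟩
    exact ⟨hx, by rw [classExp_shift_of_unhit b hb hj1 hj7 h2 h1 h2']; exact hE⟩

end DeepShift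

end Summit.KontsevichZagierPeriods.Zeta5Search.ClusterValuation

end
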